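import Literature.MathematicalPhysics.QuantumFieldTheory.Balaban1983to89.B3Eq28SummationByParts
import Literature.MathematicalPhysics.QuantumFieldTheory.Balaban1983to89.B3Sect3VectorSelfEnergy

/-!
# `Balaban1983to89.B3Taylor310Remainder` — T. Bałaban, *(Higgs)₂,₃ quantum fields in a finite volume. III. Renormalization*,
Commun. Math. Phys. **88** (1983) 411–445 [Balaban1983Higgs3]: the USES of the lattice Taylor formula (3.10) p. 435 in Sect. 3 —
the remainder of (3.10) along the staircase contour `Γ_{x,x′}` in closed form, its Hölder bound (p. 436: *"The operator acting on the
leg φ′ is a differentiation of the order 1 + α"*), and the Taylor rearrangements **(3.11)** p. 436 and **(3.26)** p. 440 with the Taylor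
hypothesis of the statement files DISCHARGED on the torus calculus

statement-level skeleton of published theorems with citation tags; proofs where landed; nothing here is a claim about the Yang–Mills mass gap

PDF held: `paper:balaban1983-higgs-2-3-quantum-fields-finite-volume` (journal page = PDF page + 410).  Read: pp. 435–437 [PDF 25–27]
((3.9)–(3.16)), p. 440 [PDF 30] ((3.26)); the displays on the ×2 renders `run/shared/lean/pub/pub-balaban/b2b-balaban-ref1/pages/
1983-cmp88-higgs23-III/1983-cmp88-higgs23-III-p025-x2.png`, `…-p026-x2.png`, `…-p030-x2.png`; never the OCR layer alone.

CITATION HEADER (lean-in-tree rule).  Part of the lit-balaban TYPED SKELETON (HOME `run/shared/lean/pub/lit-balaban/`), PHASE 2, seat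
p20 generation 2 (the seat's gen-1 file `B3Eq28SummationByParts` §6 is the (3.10) file of record: `taylor310_run`, `taylor310_stair`).
WHAT IS REPRODUCED (rows of `HOME/lit-balaban-r15/ROWS-B3.md`, fold owner r15): **B3.Eq3.10** ((3.10) p. 435: the remainder as a named
object and its bound), **B3.Eq3.11-3.17** ((3.11) p. 436 unconditional; the sentence of p. 436 on the order `1 + α` of the remainder
operator, i.e. the Hölder factor of (3.13)), **B3.Eq3.25-3.32** ((3.26) p. 440 unconditional).

THE PRINTED TEXT (verbatim).  p. 435 [PDF 25]: *"To this expression we apply Taylor's formula in the form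
f(y) = f(x) + Σ_{μ=1}^d (y_μ − x_μ)(∂^η_μ f)(x) + Σ_{b⊂Γ_{x,y}} η|b_− − x|^α ((∂^ηf)(b) − (∂^ηf)((b)_x))/|b_− − x|^α, (3.10) where (b)_x
denotes a bond b parallel-transported to the point x. We apply it to a leg φ′ …"*; p. 436 [PDF 26], after (3.11): *"The second
expression above already has the right form because the factor |x − x′|^{1+α} adds to the degree of the graph the number 1 + α, thus
the degree of the expression is equal to −d + 3 + α now. The operator acting on the leg φ′ is a differentiation of the order 1 + α"*,
and (3.13): *"… ·(L^{j₁}η)^{1+α} sup_{x∈Δ(v),x′∈Δ(v′)} sup_{y∈Γ_{x,x′},μ} |(∂^η_μφ′)(y) − (∂^η_μφ′)(x)| / |y − x|^α"*; p. 440 [PDF 30]: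
*"Let us apply the formula (3.10) to these expressions [the four graphs (3.25)]. We get … (3.26)"*.

WHAT IS TYPED / PROVED, and how.
* §1 — (3.10) on the torus `Site P j` along the staircase `Γ_{x,y}` of the series (`LatticeFieldCalculus.mixSite`/`runSite`; lattice
  factor `c = η⁻¹`): the signed step numbers `steps x y μ = n_μ` (`y_μ − x_μ = n_μη`, least absolute residue), the printed displacement
  `disp c x y μ = (y_μ − x_μ) = η·n_μ`, the FIRST-ORDER TERM `lin` (derivative at `x` along the orientation of the contour, as in
  `taylor310_stair`) and the REMAINDER `rem` (`Σ_{b⊂Γ_{x,y}} η((∂^ηf)(b) − (∂^ηf)((b)_x))`) as definitions with bodies;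
  `taylor310_eq : f y = f x + lin + rem` (= `B3Eq28SummationByParts.taylor310_stair`).  The reading with the FORWARD derivative `∂^η_μ`
  in the first-order term for both orientations — literally *"Σ_μ (y_μ − x_μ)(∂^η_μ f)(x)"*, the shape in which the statement files
  `B3Sect3ScalarSelfEnergy.eq311` / `B3Sect3VectorSelfEnergy.eq326` consume (3.10) — holds with the remainder `remFwd = rem + corr`,
  `corr = Σ_μ n⁻_μ η((∂^{η*}_μf)(x) + (∂^η_μf)(x))` (the backward runs re-expressed through `∂^η_μ` at `x`; a sum of second differences
  at `x`): `taylor310_fwd`.  Both readings are exact identities; which bond "(b)_x" is meant for a negatively traversed bond is not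
  printed (cf. the docstring of `taylor310_stair`).
* §2 — kernel lemmas of the torus: `Σ_μ (n⁺_μ + n⁻_μ) = |x − y|₁/η` (the number of bonds of `Γ_{x,y}` is the `ℓ¹` torus distance
  `Site.tdist`), every site of `Γ_{x,y}` is within `ℓ¹`-distance `|x − y|₁` of `x`, `∂^{η*}_μ f(z) = −∂^η_μ f(z − e_μ)`.
* §3 — THE HÖLDER BOUND (the p. 436 sentence / the last factor of (3.13)), PROVED: if `‖(∂^η_μf)(z) − (∂^η_μf)(z′)‖ ≤ H(η|z − z′|₁)^α`
  for all sites and directions (`0 ≤ α`, `0 ≤ H`), then `‖rem(x,y)‖ ≤ H·(η|x−y|₁)·(η|x−y|₁)^α` (`norm_rem_le`; `= H(η|x−y|₁)^{1+α}`,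
  `norm_rem_le_rpow`) and `‖remFwd(x,y)‖ ≤ 2H·(η|x−y|₁)·(η|x−y|₁)^α` (`norm_remFwd_le`).  Here `|·|₁ = Site.tdist` (lattice steps); the
  print's `|x′ − x|` is a lattice distance with an unspecified norm (`Setup` DIVERGENCE F2) — with the `ℓ¹` choice `Σ_{b⊂Γ_{x,x′}} η =
  |x′ − x|` exactly.
* §4 — **(3.11)** with the Taylor hypothesis `hT` of `B3Sect3ScalarSelfEnergy.eq311` DISCHARGED: `eq311_taylor` (no hypothesis besides
  `η ≠ 0`; `dx μ x x′ = disp η⁻¹ x x′ μ` = the printed `(x′_μ − x_μ)`, `D μ = ∂^η_μφ′ = pdiff η⁻¹ μ φ′`, `R = remFwd η⁻¹ φ′`).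
* §5 — **(3.26)** with the Taylor hypothesis `hT` of `B3Sect3VectorSelfEnergy.eq326` DISCHARGED: `eq326_taylor` (Taylor's formula applied
  to each leg function `x ↦ g′(x)A′_{μ′}(x)`; `D ν μ′ = ∂^η_ν(g′A′_{μ′})`).
DELIBERATELY NOT HERE: the kernel estimates (2.10)–(2.12) that turn the Hölder bound into (3.13)/(3.14) (row B3.Eq2.10 ff., inputs from
[Balaban1982Higgs1] Props. 2.1/2.3), the pictures (3.12)/(3.17), the cube localization of (3.13) (row B3.Eq2.13-2.14, seat p19).
No file of another seat is modified (imports only).  Unit `lit-balaban-p20` (literature-prover-lit-balaban-p20-g2-0), 2026-08-21;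
HOME/FILED.md records the proposal.
-/

open scoped BigOperators RealInnerProductSpace

namespace Literature.MathematicalPhysics.QuantumFieldTheory.Balaban1983to89.B3Taylor310Remainder

open LatticeFieldCalculus B3Eq28SummationByParts B3Sect3ScalarSelfEnergy B3Sect3VectorSelfEnergy

noncomputable section

/-! ## 1. (3.10) along `Γ_{x,y}`: step numbers, displacement, first-order term, remainder -/

section Defs

variable {P : Params} {j : ℕ} {V : Type*} [AddCommGroup V] [Module ℝ V]

/-- The signed number of lattice steps `n_μ` of the staircase `Γ_{x,y}` in the direction `μ` (`y_μ − x_μ = n_μ·η` on the torus, `n_μ` the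
residue of least absolute value, as in `LatticeFieldCalculus.stairSum`). [cite: Balaban1983Higgs3, (3.10) p.435] -/
def steps (x y : Site P j) (μ : Fin P.d) : ℤ := (y μ - x μ).valMinAbs

/-- The printed displacement `(y_μ − x_μ) = η·n_μ` of (3.10), `η = c⁻¹`. [cite: Balaban1983Higgs3, (3.10) p.435] -/
def disp (c : ℝ) (x y : Site P j) (μ : Fin P.d) : ℝ := c⁻¹ * (steps x y μ : ℝ)

/-- The FIRST-ORDER TERM of (3.10) along `Γ_{x,y}` with the derivative at `x` read along the orientation of the contour: `Σ_μ (n⁺_μ η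
(∂^η_μ f)(x) + n⁻_μ η(∂^{η*}_μ f)(x))`, `n⁺ = max(n_μ,0)`, `n⁻ = max(−n_μ,0)` (the shape of `B3Eq28SummationByParts.taylor310_stair`).
[cite: Balaban1983Higgs3, (3.10) p.435] -/
def lin (c : ℝ) (f : SiteField P j V) (x y : Site P j) : V :=
  ∑ μ : Fin P.d, ((((steps x y μ).toNat : ℕ) : ℝ) • c⁻¹ • pdiff c μ f x
    + (((-steps x y μ).toNat : ℕ) : ℝ) • c⁻¹ • pdiffAdj c μ f x)

/-- The remainder of (3.10) collected on the POSITIVELY traversed run of `Γ_{x,y}` in the direction `μ` (bonds `b_t = ⟨p + te_μ, p + (t+1)e_μ⟩`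
from the corner `p = mixSite μ x y`): `Σ_t η((∂^η_μ f)(p + te_μ) − (∂^η_μ f)(x))`. [cite: Balaban1983Higgs3, (3.10) p.435] -/
def remUp (c : ℝ) (f : SiteField P j V) (x y : Site P j) (μ : Fin P.d) : V :=
  ∑ t ∈ Finset.range (steps x y μ).toNat, c⁻¹ • (pdiff c μ f (runSite (mixSite μ x y) μ t) - pdiff c μ f x)

/-- The remainder of (3.10) collected on the NEGATIVELY traversed run of `Γ_{x,y}` in the direction `μ` (reversed bonds `−⟨z − e_μ, z⟩`,
`z = p − te_μ`): `Σ_t η((∂^{η*}_μ f)(p − te_μ) − (∂^{η*}_μ f)(x))`. [cite: Balaban1983Higgs3, (3.10) p.435] -/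
def remDown (c : ℝ) (f : SiteField P j V) (x y : Site P j) (μ : Fin P.d) : V :=
  ∑ t ∈ Finset.range (-steps x y μ).toNat,
    c⁻¹ • (pdiffAdj c μ f (Function.update (mixSite μ x y) μ (x μ - (t : ZMod (P.sitesPerDir j)))) - pdiffAdj c μ f x)

/-- THE REMAINDER of (3.10) along `Γ_{x,y}`, verbatim *"Σ_{b⊂Γ_{x,y}} η|b_− − x|^α ((∂^ηf)(b) − (∂^ηf)((b)_x))/|b_− − x|^α"* (the factors
`|b_− − x|^α/|b_− − x|^α = 1` only exhibit the Hölder quotient), as the sum over the `d` runs of the staircase.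
[cite: Balaban1983Higgs3, (3.10) p.435] -/
def rem (c : ℝ) (f : SiteField P j V) (x y : Site P j) : V :=
  ∑ μ : Fin P.d, (remUp c f x y μ + remDown c f x y μ)

/-- **(3.10)** p. 435 [PDF 25] along the staircase `Γ_{x,y}`: `f(y) = f(x) + [first-order term] + [remainder]` — the identity
`B3Eq28SummationByParts.taylor310_stair` with the two printed pieces named. [cite: Balaban1983Higgs3, (3.10) p.435] -/
theorem taylor310_eq (c : ℝ) (hc : c ≠ 0) (f : SiteField P j V) (x y : Site P j) :
    f y = f x + lin c f x y + rem c f x y := by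
  simp only [lin, rem, remUp, remDown, steps]
  exact taylor310_stair c hc f x y

/-- The ORIENTATION CORRECTION between the two readings of the first-order term of (3.10): `Σ_μ n⁻_μ η((∂^{η*}_μ f)(x) + (∂^η_μ f)(x))`
(each summand a second difference `f(x + e_μ) − 2f(x) + f(x − e_μ)` times the number of backward steps). [cite: Balaban1983Higgs3, (3.10) p.435] -/
def corr (c : ℝ) (f : SiteField P j V) (x y : Site P j) : V :=
  ∑ μ : Fin P.d, (((-steps x y μ).toNat : ℕ) : ℝ) • c⁻¹ • (pdiffAdj c μ f x + pdiff c μ f x)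

/-- The remainder of (3.10) in the FORWARD-DERIVATIVE reading of its first-order term (`remFwd = rem + corr`).
[cite: Balaban1983Higgs3, (3.10) p.435] -/
def remFwd (c : ℝ) (f : SiteField P j V) (x y : Site P j) : V :=
  rem c f x y + corr c f x y

/-- kernel: `n⁺ − n⁻ = n`. [folklore] -/
private theorem toNat_sub_toNat_neg_real (n : ℤ) : ((n.toNat : ℕ) : ℝ) - (((-n).toNat : ℕ) : ℝ) = (n : ℝ) := by
  have h := Int.toNat_sub_toNat_neg n
  exact_mod_cast h

/-- The first-order term in the two readings: `lin = Σ_μ (y_μ − x_μ)(∂^η_μ f)(x) + corr`. [cite: Balaban1983Higgs3, (3.10) p.435] -/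
theorem lin_eq_disp_add_corr (c : ℝ) (f : SiteField P j V) (x y : Site P j) :
    lin c f x y = (∑ μ : Fin P.d, disp c x y μ • pdiff c μ f x) + corr c f x y := by
  simp only [lin, corr, disp, ← Finset.sum_add_distrib]
  refine Finset.sum_congr rfl fun μ _ => ?_
  rw [← toNat_sub_toNat_neg_real (steps x y μ)]
  module

/-- **(3.10)** p. 435 [PDF 25] read with the FORWARD derivative in the first-order term, literally *"f(y) = f(x) + Σ_{μ=1}^d (y_μ − x_μ)
(∂^η_μ f)(x) + [remainder]"*: `f(y) − f(x) = Σ_μ (y_μ − x_μ)·(∂^η_μ f)(x) + remFwd(x,y)` — the shape of the Taylor hypothesis `hT` of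
`B3Sect3ScalarSelfEnergy.eq311` and `B3Sect3VectorSelfEnergy.eq326`. [cite: Balaban1983Higgs3, (3.10) p.435] -/
theorem taylor310_fwd (c : ℝ) (hc : c ≠ 0) (f : SiteField P j V) (x y : Site P j) :
    f y - f x = (∑ μ : Fin P.d, disp c x y μ • pdiff c μ f x) + remFwd c f x y := by
  rw [taylor310_eq c hc f x y, lin_eq_disp_add_corr, remFwd]
  abel

end Defs

/-! ## 2. Torus kernel lemmas: the number of bonds of `Γ_{x,y}`, the sites of `Γ_{x,y}`, `∂^{η*}` versus `∂^η` -/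

section TorusLemmas

variable {P : Params} {j : ℕ}

/-- kernel: the least-absolute-value residue measures the torus distance of one coordinate: `|n_μ| = min((−a).val, a.val)`,
`a = y_μ − x_μ`. [folklore] -/
private theorem natAbs_valMinAbs_eq_min {n : ℕ} [NeZero n] (a : ZMod n) :
    a.valMinAbs.natAbs = min (-a).val a.val := by
  rw [ZMod.valMinAbs_natAbs_eq_min, ZMod.neg_val]
  split_ifs with h
  · subst h; simp
  · rw [min_comm]

/-- kernel: `n⁺_μ + n⁻_μ = |n_μ|` is the `μ`-th summand of the `ℓ¹` torus distance `Site.tdist x y`. [folklore] -/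
private theorem toNat_add_toNat_neg_steps (x y : Site P j) (μ : Fin P.d) :
    (steps x y μ).toNat + (-steps x y μ).toNat = min (x μ - y μ).val (y μ - x μ).val := by
  rw [Int.toNat_add_toNat_neg_eq_natAbs, steps, natAbs_valMinAbs_eq_min, neg_sub]

/-- The number of bonds of the staircase `Γ_{x,y}` is the `ℓ¹` torus distance: `Σ_μ (n⁺_μ + n⁻_μ) = |x − y|₁` (lattice steps), i.e.
`Σ_{b⊂Γ_{x,y}} η = |x − y|`. [cite: Balaban1983Higgs3, (3.10) p.435] -/
theorem sum_steps_eq_tdist (x y : Site P j) :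
    ∑ μ : Fin P.d, ((steps x y μ).toNat + (-steps x y μ).toNat) = Site.tdist x y := by
  simp only [toNat_add_toNat_neg_steps, Site.tdist]

/-- kernel: `ℓ¹` torus distance is symmetric. [folklore] -/
private theorem tdist_comm (x y : Site P j) : Site.tdist x y = Site.tdist y x := by
  simp only [Site.tdist, min_comm]

/-- kernel: the `μ`-coordinate of the corner `mixSite μ x y` is still `x_μ`. [folklore] -/
private theorem mixSite_self (μ : Fin P.d) (x y : Site P j) : mixSite μ x y μ = x μ := by
  simp [mixSite]

/-- kernel: a coordinate `ν ≠ μ` of the corner `mixSite μ x y` is `x_ν` or `y_ν`; its contribution to the distance from `x` is at most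
that of `y`. [folklore] -/
private theorem min_val_mixSite_le (μ ν : Fin P.d) (x y : Site P j) :
    min (mixSite μ x y ν - x ν).val (x ν - mixSite μ x y ν).val ≤ min (x ν - y ν).val (y ν - x ν).val := by
  unfold mixSite
  split_ifs with h
  · rw [min_comm]
  · simp

/-- kernel: `(t : ZMod n).val ≤ t`. [folklore] -/
private theorem val_natCast_le {n : ℕ} [NeZero n] (t : ℕ) : ((t : ZMod n)).val ≤ t := by
  rw [ZMod.val_natCast]; exact Nat.mod_le _ _

/-- The sites of the positively traversed run of `Γ_{x,y}` in the direction `μ` stay within `ℓ¹`-distance `|x − y|₁` of `x`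
(`t ≤ |n_μ|` steps from the corner). [cite: Balaban1983Higgs3, (3.10) p.435] -/
theorem tdist_runSite_mixSite_le (x y : Site P j) (μ : Fin P.d) {t : ℕ} (ht : t ≤ (steps x y μ).natAbs) :
    Site.tdist (runSite (mixSite μ x y) μ t) x ≤ Site.tdist x y := by
  unfold Site.tdist
  refine Finset.sum_le_sum fun ν _ => ?_
  by_cases hν : ν = μ
  · subst hν
    simp only [runSite, Function.update_self, mixSite_self, add_sub_cancel_left]
    calc min ((t : ZMod (P.sitesPerDir j))).val (x ν - (x ν + (t : ZMod (P.sitesPerDir j)))).val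
        ≤ ((t : ZMod (P.sitesPerDir j))).val := min_le_left _ _
      _ ≤ t := val_natCast_le t
      _ ≤ (steps x y ν).natAbs := ht
      _ = min (x ν - y ν).val (y ν - x ν).val := by
          rw [← Int.toNat_add_toNat_neg_eq_natAbs, toNat_add_toNat_neg_steps]
  · simp only [runSite, Function.update_of_ne hν]
    exact min_val_mixSite_le μ ν x y

/-- The sites of the negatively traversed run of `Γ_{x,y}` in the direction `μ` stay within `ℓ¹`-distance `|x − y|₁` of `x`.
[cite: Balaban1983Higgs3, (3.10) p.435] -/
theorem tdist_downSite_mixSite_le (x y : Site P j) (μ : Fin P.d) {t : ℕ} (ht : t ≤ (steps x y μ).natAbs) :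
    Site.tdist (Function.update (mixSite μ x y) μ (x μ - (t : ZMod (P.sitesPerDir j)))) x ≤ Site.tdist x y := by
  unfold Site.tdist
  refine Finset.sum_le_sum fun ν _ => ?_
  by_cases hν : ν = μ
  · subst hν
    simp only [Function.update_self, sub_sub_cancel_left, sub_sub_cancel]
    calc min (-(t : ZMod (P.sitesPerDir j))).val ((t : ZMod (P.sitesPerDir j))).val
        ≤ ((t : ZMod (P.sitesPerDir j))).val := min_le_right _ _
      _ ≤ t := val_natCast_le t
      _ ≤ (steps x y ν).natAbs := ht
      _ = min (x ν - y ν).val (y ν - x ν).val := by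
          rw [← Int.toNat_add_toNat_neg_eq_natAbs, toNat_add_toNat_neg_steps]
  · simp only [Function.update_of_ne hν]
    exact min_val_mixSite_le μ ν x y

/-- kernel: `(z − e_μ) + e_μ = z` on the torus. [folklore] -/
private theorem shift_unshift' (z : Site P j) (μ : Fin P.d) : (z.unshift μ).shift μ = z := by
  funext ν
  by_cases h : ν = μ
  · subst h; simp [Site.shift, Site.unshift]
  · simp [Site.shift, Site.unshift, Function.update_of_ne h]

/-- kernel: translating both sites by `−e_μ` does not change the `ℓ¹` torus distance. [folklore] -/
private theorem tdist_unshift_unshift (z z' : Site P j) (μ : Fin P.d) :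
    Site.tdist (z.unshift μ) (z'.unshift μ) = Site.tdist z z' := by
  unfold Site.tdist
  refine Finset.sum_congr rfl fun ν _ => ?_
  by_cases h : ν = μ
  · subst h; simp [Site.unshift, sub_sub_sub_cancel_right]
  · simp [Site.unshift, Function.update_of_ne h]

/-- kernel: nearest neighbours are at `ℓ¹` torus distance at most one. [folklore] -/
private theorem tdist_unshift_le_one (z : Site P j) (μ : Fin P.d) : Site.tdist z (z.unshift μ) ≤ 1 := by
  unfold Site.tdist
  have h1 : ∀ ν : Fin P.d, min (z ν - z.unshift μ ν).val (z.unshift μ ν - z ν).val ≤ if ν = μ then 1 else 0 := by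
    intro ν
    by_cases h : ν = μ
    · subst h
      simp only [Site.unshift, Function.update_self, sub_sub_cancel, if_true]
      calc min (1 : ZMod (P.sitesPerDir j)).val (z ν - 1 - z ν).val ≤ (1 : ZMod (P.sitesPerDir j)).val := min_le_left _ _
        _ = ((1 : ℕ) : ZMod (P.sitesPerDir j)).val := by rw [Nat.cast_one]
        _ ≤ 1 := val_natCast_le 1
    · simp [Site.unshift, h]
  calc ∑ ν : Fin P.d, min (z ν - z.unshift μ ν).val (z.unshift μ ν - z ν).val
      ≤ ∑ ν : Fin P.d, (if ν = μ then 1 else 0) := Finset.sum_le_sum fun ν _ => h1 ν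
    _ = 1 := by simp

variable {V : Type*} [AddCommGroup V] [Module ℝ V]

/-- The backward difference is minus the forward difference one step back, `(∂^{η*}_μ f)(z) = −(∂^η_μ f)(z − e_μ)`: the reversed-bond
convention `A_{⟨x,x′⟩} = −A_{⟨x′,x⟩}` of the series applied to `∂f`. [cite: Balaban1984PropagatorsI, (1.7) p.18] -/
theorem pdiffAdj_eq_neg_pdiff_unshift (c : ℝ) (μ : Fin P.d) (f : SiteField P j V) (z : Site P j) :
    pdiffAdj c μ f z = -pdiff c μ f (z.unshift μ) := by
  simp only [pdiffAdj, pdiff, shift_unshift', ← smul_neg, neg_sub]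

end TorusLemmas

/-! ## 3. The Hölder bound on the remainder: "a differentiation of the order 1 + α" (p. 436) -/

section Bounds

variable {P : Params} {j : ℕ} {V : Type*} [NormedAddCommGroup V] [NormedSpace ℝ V]

/-- The Hölder hypothesis on the lattice derivative of the leg: `‖(∂^η_μ f)(z) − (∂^η_μ f)(z′)‖ ≤ H·(η|z − z′|₁)^α` for all sites and
directions — the quotient `sup_{y,μ} |(∂^η_μφ′)(y) − (∂^η_μφ′)(x)|/|y − x|^α` of (3.13) p. 436 (part of the norm (1.32) `‖·‖_{1,α}`), with
`|·|₁` the `ℓ¹` torus distance in lattice steps and `η = c⁻¹`. [cite: Balaban1983Higgs3, (3.13) p.436] -/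
def HolderDeriv (c α H : ℝ) (f : SiteField P j V) : Prop :=
  ∀ (μ : Fin P.d) (z z' : Site P j), ‖pdiff c μ f z - pdiff c μ f z'‖ ≤ H * (c⁻¹ * (Site.tdist z z' : ℝ)) ^ α

omit [NormedSpace ℝ V] in
/-- kernel: monotonicity of the Hölder weight in the distance. [folklore] -/
private theorem holder_weight_mono {c α H : ℝ} (hc : 0 < c) (hα : 0 ≤ α) (hH : 0 ≤ H) {a b : ℕ} (hab : a ≤ b) :
    H * (c⁻¹ * (a : ℝ)) ^ α ≤ H * (c⁻¹ * (b : ℝ)) ^ α := by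
  refine mul_le_mul_of_nonneg_left (Real.rpow_le_rpow ?_ ?_ hα) hH
  · exact mul_nonneg (inv_nonneg.mpr hc.le) (Nat.cast_nonneg _)
  · exact mul_le_mul_of_nonneg_left (by exact_mod_cast hab) (inv_nonneg.mpr hc.le)

/-- The remainder on a positive run: at most `n⁺_μ · η · H(η|x − y|₁)^α`. [cite: Balaban1983Higgs3, (3.13) p.436] -/
theorem norm_remUp_le {c α H : ℝ} (hc : 0 < c) (hα : 0 ≤ α) (hH : 0 ≤ H) {f : SiteField P j V} (hf : HolderDeriv c α H f)
    (x y : Site P j) (μ : Fin P.d) :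
    ‖remUp c f x y μ‖ ≤ ((steps x y μ).toNat : ℝ) * (c⁻¹ * (H * (c⁻¹ * (Site.tdist x y : ℝ)) ^ α)) := by
  unfold remUp
  have hterm : ∀ t ∈ Finset.range (steps x y μ).toNat,
      ‖c⁻¹ • (pdiff c μ f (runSite (mixSite μ x y) μ t) - pdiff c μ f x)‖ ≤ c⁻¹ * (H * (c⁻¹ * (Site.tdist x y : ℝ)) ^ α) := by
    intro t ht
    rw [norm_smul, Real.norm_of_nonneg (inv_nonneg.mpr hc.le)]
    refine mul_le_mul_of_nonneg_left ?_ (inv_nonneg.mpr hc.le)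
    refine (hf μ _ x).trans (holder_weight_mono hc hα hH ?_)
    refine tdist_runSite_mixSite_le x y μ ?_
    have h1 : t < (steps x y μ).toNat := Finset.mem_range.mp ht
    have h2 : (steps x y μ).toNat ≤ (steps x y μ).natAbs := by
      rw [← Int.toNat_add_toNat_neg_eq_natAbs]; exact Nat.le_add_right _ _
    omega
  calc ‖∑ t ∈ Finset.range (steps x y μ).toNat, c⁻¹ • (pdiff c μ f (runSite (mixSite μ x y) μ t) - pdiff c μ f x)‖
      ≤ ∑ t ∈ Finset.range (steps x y μ).toNat, ‖c⁻¹ • (pdiff c μ f (runSite (mixSite μ x y) μ t) - pdiff c μ f x)‖ :=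
        norm_sum_le _ _
    _ ≤ ∑ t ∈ Finset.range (steps x y μ).toNat, c⁻¹ * (H * (c⁻¹ * (Site.tdist x y : ℝ)) ^ α) := Finset.sum_le_sum hterm
    _ = ((steps x y μ).toNat : ℝ) * (c⁻¹ * (H * (c⁻¹ * (Site.tdist x y : ℝ)) ^ α)) := by
        rw [Finset.sum_const, Finset.card_range, nsmul_eq_mul]

/-- The remainder on a negative run: at most `n⁻_μ · η · H(η|x − y|₁)^α` (the backward differences are forward differences one step back,
at the same mutual distance). [cite: Balaban1983Higgs3, (3.13) p.436] -/
theorem norm_remDown_le {c α H : ℝ} (hc : 0 < c) (hα : 0 ≤ α) (hH : 0 ≤ H) {f : SiteField P j V} (hf : HolderDeriv c α H f)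
    (x y : Site P j) (μ : Fin P.d) :
    ‖remDown c f x y μ‖ ≤ ((-steps x y μ).toNat : ℝ) * (c⁻¹ * (H * (c⁻¹ * (Site.tdist x y : ℝ)) ^ α)) := by
  unfold remDown
  have hterm : ∀ t ∈ Finset.range (-steps x y μ).toNat,
      ‖c⁻¹ • (pdiffAdj c μ f (Function.update (mixSite μ x y) μ (x μ - (t : ZMod (P.sitesPerDir j)))) - pdiffAdj c μ f x)‖
        ≤ c⁻¹ * (H * (c⁻¹ * (Site.tdist x y : ℝ)) ^ α) := by
    intro t ht
    rw [norm_smul, Real.norm_of_nonneg (inv_nonneg.mpr hc.le)]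
    refine mul_le_mul_of_nonneg_left ?_ (inv_nonneg.mpr hc.le)
    rw [pdiffAdj_eq_neg_pdiff_unshift, pdiffAdj_eq_neg_pdiff_unshift, neg_sub_neg, norm_sub_rev]
    refine (hf μ _ _).trans ?_
    rw [tdist_unshift_unshift]
    refine holder_weight_mono hc hα hH (tdist_downSite_mixSite_le x y μ ?_)
    have h1 : t < (-steps x y μ).toNat := Finset.mem_range.mp ht
    have h2 : (-steps x y μ).toNat ≤ (steps x y μ).natAbs := by
      rw [← Int.toNat_add_toNat_neg_eq_natAbs]; exact Nat.le_add_left _ _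
    omega
  calc ‖∑ t ∈ Finset.range (-steps x y μ).toNat,
          c⁻¹ • (pdiffAdj c μ f (Function.update (mixSite μ x y) μ (x μ - (t : ZMod (P.sitesPerDir j)))) - pdiffAdj c μ f x)‖
      ≤ ∑ t ∈ Finset.range (-steps x y μ).toNat,
          ‖c⁻¹ • (pdiffAdj c μ f (Function.update (mixSite μ x y) μ (x μ - (t : ZMod (P.sitesPerDir j)))) - pdiffAdj c μ f x)‖ :=
        norm_sum_le _ _
    _ ≤ ∑ t ∈ Finset.range (-steps x y μ).toNat, c⁻¹ * (H * (c⁻¹ * (Site.tdist x y : ℝ)) ^ α) := Finset.sum_le_sum hterm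
    _ = ((-steps x y μ).toNat : ℝ) * (c⁻¹ * (H * (c⁻¹ * (Site.tdist x y : ℝ)) ^ α)) := by
        rw [Finset.sum_const, Finset.card_range, nsmul_eq_mul]

/-- **THE HÖLDER BOUND ON THE REMAINDER OF (3.10)** — p. 436 [PDF 26], *"the factor |x − x′|^{1+α} adds to the degree of the graph the
number 1 + α … The operator acting on the leg φ′ is a differentiation of the order 1 + α"* made quantitative: under the Hölder hypothesis
`‖(∂^η_μf)(z) − (∂^η_μf)(z′)‖ ≤ H(η|z − z′|₁)^α`, `‖rem(x,y)‖ ≤ H · (η|x − y|₁) · (η|x − y|₁)^α` (the number of bonds of `Γ_{x,y}` is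
`|x − y|₁`, each contributes `η·H(η|x − y|₁)^α` since every site of `Γ_{x,y}` is within `|x − y|₁` of `x`). PROVED.
[cite: Balaban1983Higgs3, (3.13) p.436] -/
theorem norm_rem_le {c α H : ℝ} (hc : 0 < c) (hα : 0 ≤ α) (hH : 0 ≤ H) {f : SiteField P j V} (hf : HolderDeriv c α H f)
    (x y : Site P j) :
    ‖rem c f x y‖ ≤ H * (c⁻¹ * (Site.tdist x y : ℝ)) * (c⁻¹ * (Site.tdist x y : ℝ)) ^ α := by
  unfold rem
  set K : ℝ := c⁻¹ * (H * (c⁻¹ * (Site.tdist x y : ℝ)) ^ α) with hK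
  calc ‖∑ μ : Fin P.d, (remUp c f x y μ + remDown c f x y μ)‖
      ≤ ∑ μ : Fin P.d, ‖remUp c f x y μ + remDown c f x y μ‖ := norm_sum_le _ _
    _ ≤ ∑ μ : Fin P.d, ((((steps x y μ).toNat : ℕ) : ℝ) * K + (((-steps x y μ).toNat : ℕ) : ℝ) * K) :=
        Finset.sum_le_sum fun μ _ =>
          (norm_add_le _ _).trans (add_le_add (norm_remUp_le hc hα hH hf x y μ) (norm_remDown_le hc hα hH hf x y μ))
    _ = (∑ μ : Fin P.d, (((steps x y μ).toNat + (-steps x y μ).toNat : ℕ) : ℝ)) * K := by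
        rw [Finset.sum_mul]
        refine Finset.sum_congr rfl fun μ _ => ?_
        push_cast; ring
    _ = (Site.tdist x y : ℝ) * K := by
        rw [← sum_steps_eq_tdist x y]; push_cast; rfl
    _ = H * (c⁻¹ * (Site.tdist x y : ℝ)) * (c⁻¹ * (Site.tdist x y : ℝ)) ^ α := by rw [hK]; ring

/-- The same bound in the printed exponent form `‖rem(x,y)‖ ≤ H·(η|x − y|₁)^{1+α}` (*"a differentiation of the order 1 + α"*).
[cite: Balaban1983Higgs3, (3.13) p.436] -/
theorem norm_rem_le_rpow {c α H : ℝ} (hc : 0 < c) (hα : 0 ≤ α) (hH : 0 ≤ H) {f : SiteField P j V} (hf : HolderDeriv c α H f)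
    (x y : Site P j) :
    ‖rem c f x y‖ ≤ H * (c⁻¹ * (Site.tdist x y : ℝ)) ^ (1 + α) := by
  have h0 : 0 ≤ c⁻¹ * (Site.tdist x y : ℝ) := mul_nonneg (inv_nonneg.mpr hc.le) (Nat.cast_nonneg _)
  rw [Real.rpow_add' h0 (by linarith), Real.rpow_one, ← mul_assoc]
  exact norm_rem_le hc hα hH hf x y

/-- The orientation correction obeys the same bound: `‖corr(x,y)‖ ≤ H·(η|x − y|₁)·(η|x − y|₁)^α` (each second difference at `x` is a
difference of `∂^η_μ f` at the neighbouring sites `x`, `x − e_μ`, and `n⁻_μ ≥ 1` forces `|x − y|₁ ≥ 1`). [cite: Balaban1983Higgs3, (3.13) p.436] -/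
theorem norm_corr_le {c α H : ℝ} (hc : 0 < c) (hα : 0 ≤ α) (hH : 0 ≤ H) {f : SiteField P j V} (hf : HolderDeriv c α H f)
    (x y : Site P j) :
    ‖corr c f x y‖ ≤ H * (c⁻¹ * (Site.tdist x y : ℝ)) * (c⁻¹ * (Site.tdist x y : ℝ)) ^ α := by
  unfold corr
  set K : ℝ := c⁻¹ * (H * (c⁻¹ * (Site.tdist x y : ℝ)) ^ α) with hK
  have hterm : ∀ μ : Fin P.d,
      ‖(((-steps x y μ).toNat : ℕ) : ℝ) • c⁻¹ • (pdiffAdj c μ f x + pdiff c μ f x)‖ ≤ (((-steps x y μ).toNat : ℕ) : ℝ) * K := by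
    intro μ
    rcases Nat.eq_zero_or_pos (-steps x y μ).toNat with h0 | hpos
    · rw [h0]; simp
    rw [norm_smul, norm_smul, Real.norm_of_nonneg (Nat.cast_nonneg _), Real.norm_of_nonneg (inv_nonneg.mpr hc.le), hK]
    refine mul_le_mul_of_nonneg_left (mul_le_mul_of_nonneg_left ?_ (inv_nonneg.mpr hc.le)) (Nat.cast_nonneg _)
    rw [pdiffAdj_eq_neg_pdiff_unshift, neg_add_eq_sub]
    refine (hf μ x (x.unshift μ)).trans (holder_weight_mono hc hα hH ?_)
    refine (tdist_unshift_le_one x μ).trans ?_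
    -- `n⁻_μ ≥ 1` bonds in direction `μ` force `|x − y|₁ ≥ 1`
    have h2 : (-steps x y μ).toNat ≤ Site.tdist x y := by
      rw [← sum_steps_eq_tdist x y]
      exact (Nat.le_add_left _ _).trans
        (Finset.single_le_sum (f := fun ν => (steps x y ν).toNat + (-steps x y ν).toNat) (fun _ _ => Nat.zero_le _)
          (Finset.mem_univ μ))
    omega
  calc ‖∑ μ : Fin P.d, (((-steps x y μ).toNat : ℕ) : ℝ) • c⁻¹ • (pdiffAdj c μ f x + pdiff c μ f x)‖
      ≤ ∑ μ : Fin P.d, ‖(((-steps x y μ).toNat : ℕ) : ℝ) • c⁻¹ • (pdiffAdj c μ f x + pdiff c μ f x)‖ := norm_sum_le _ _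
    _ ≤ ∑ μ : Fin P.d, (((-steps x y μ).toNat : ℕ) : ℝ) * K := Finset.sum_le_sum fun μ _ => hterm μ
    _ ≤ ∑ μ : Fin P.d, (((steps x y μ).toNat + (-steps x y μ).toNat : ℕ) : ℝ) * K := by
        refine Finset.sum_le_sum fun μ _ => mul_le_mul_of_nonneg_right (by exact_mod_cast Nat.le_add_left _ _) ?_
        rw [hK]
        exact mul_nonneg (inv_nonneg.mpr hc.le) (mul_nonneg hH (Real.rpow_nonneg
          (mul_nonneg (inv_nonneg.mpr hc.le) (Nat.cast_nonneg _)) _))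
    _ = (Site.tdist x y : ℝ) * K := by
        rw [← Finset.sum_mul, ← sum_steps_eq_tdist x y]; push_cast; rfl
    _ = H * (c⁻¹ * (Site.tdist x y : ℝ)) * (c⁻¹ * (Site.tdist x y : ℝ)) ^ α := by rw [hK]; ring

/-- The remainder of the forward-derivative reading: `‖remFwd(x,y)‖ ≤ 2H·(η|x − y|₁)·(η|x − y|₁)^α` — still "a differentiation of the
order 1 + α" acting on the leg. [cite: Balaban1983Higgs3, (3.13) p.436] -/
theorem norm_remFwd_le {c α H : ℝ} (hc : 0 < c) (hα : 0 ≤ α) (hH : 0 ≤ H) {f : SiteField P j V} (hf : HolderDeriv c α H f)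
    (x y : Site P j) :
    ‖remFwd c f x y‖ ≤ 2 * H * (c⁻¹ * (Site.tdist x y : ℝ)) * (c⁻¹ * (Site.tdist x y : ℝ)) ^ α := by
  unfold remFwd
  calc ‖rem c f x y + corr c f x y‖ ≤ ‖rem c f x y‖ + ‖corr c f x y‖ := norm_add_le _ _
    _ ≤ H * (c⁻¹ * (Site.tdist x y : ℝ)) * (c⁻¹ * (Site.tdist x y : ℝ)) ^ α
        + H * (c⁻¹ * (Site.tdist x y : ℝ)) * (c⁻¹ * (Site.tdist x y : ℝ)) ^ α :=
        add_le_add (norm_rem_le hc hα hH hf x y) (norm_corr_le hc hα hH hf x y)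
    _ = 2 * H * (c⁻¹ * (Site.tdist x y : ℝ)) * (c⁻¹ * (Site.tdist x y : ℝ)) ^ α := by ring

end Bounds

/-! ## 4. (3.11) with the Taylor hypothesis discharged -/

section Eq311

variable {P : Params} {j : ℕ} {W : Type*} [NormedAddCommGroup W] [InnerProductSpace ℝ W]

/-- **(3.11)** p. 436 [PDF 26], verbatim: *"We get (the expression (3.9)) = − Σ_{μ=1}^d Σ_x η^dφ(x)·[Σ_{x′}η^dΣ_{ν=1}^d
q(∂^η_νG_{(j)}(0)∂^{η*}_ν)(x,x′)q·g(x)G_{(j′)}(x,x′)g′(x′)(x′_μ − x_μ)](∂^η_μφ′)(x) − Σ_{x,x′}η^{2d}φ(x)·[qΣ_{μ=1}^d(∂^η_μG_{(j)}(0)∂^{η*}_μ)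
(x,x′)qg(x)G_{(j′)}(x,x′)g′(x′)|x′−x|^{1+α}]·Σ_{b⊂Γ_{x,x′}}(η|b_−−x|^α/|x′−x|^{1+α})((∂^ηφ′)(b) − (∂^ηφ′)((b)_x))/|b_−−x|^α. (3.11)"* —
PROVED UNCONDITIONALLY on the torus calculus: `B3Sect3ScalarSelfEnergy.eq311` with its Taylor hypothesis `hT` supplied by (3.10) along
`Γ_{x,x′}` (`taylor310_fwd`): `dx μ x x′ = (x′_μ − x_μ) = disp η⁻¹ x x′ μ`, `D μ = ∂^η_μφ′`, remainder `R = remFwd η⁻¹ φ′` (the insert-and-divide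
by `|x′ − x|^{1+α}` is not performed, as in `eq311`; its effect is `norm_remFwd_le`). [cite: Balaban1983Higgs3, (3.11) p.436] -/
theorem eq311_taylor (η : ℝ) (hη : η ≠ 0) (q : W →ₗ[ℝ] W) (Gj Gj' : Kernel P j) (g g' : SiteField P j ℝ)
    (φ φ' : SiteField P j W) :
    expr39 η q Gj Gj' g g' φ φ' =
      -(∑ μ : Fin P.d, ∑ x : Site P j, η ^ P.d *
          ((∑ x' : Site P j, η ^ P.d * (coeff39 η Gj Gj' g g' x x' * disp η⁻¹ x x' μ)) *
            ⟪φ x, q (q (pdiff η⁻¹ μ φ' x))⟫)) -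
        ∑ x : Site P j, ∑ x' : Site P j, η ^ (2 * P.d) *
          (coeff39 η Gj Gj' g g' x x' * ⟪φ x, q (q (remFwd η⁻¹ φ' x x'))⟫) :=
  eq311 η q Gj Gj' g g' φ φ' (fun μ x x' => disp η⁻¹ x x' μ) (fun μ => pdiff η⁻¹ μ φ') (fun x x' => remFwd η⁻¹ φ' x x')
    fun x x' => taylor310_fwd η⁻¹ (inv_ne_zero hη) φ' x x'

/-- The displacement with `c = η⁻¹` is literally `η·n_μ = (x′_μ − x_μ)`. [cite: Balaban1983Higgs3, (3.11) p.436] -/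
theorem disp_inv (η : ℝ) (x x' : Site P j) (μ : Fin P.d) : disp η⁻¹ x x' μ = η * (steps x x' μ : ℝ) := by
  rw [disp, inv_inv]

end Eq311

/-! ## 5. (3.26) with the Taylor hypothesis discharged -/

section Eq326

variable {P : Params} {j : ℕ}

/-- The leg function `x ↦ g′(x)A′_{μ′}(x)` of (3.26) to which (3.10) is applied (`A′_{μ′}(x) = A′⟨x, μ′⟩`). [cite: Balaban1983Higgs3, (3.26) p.440] -/
def legFn (g' : SiteField P j ℝ) (A' : VecField P j ℝ) (μ' : Fin P.d) : SiteField P j ℝ :=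
  fun x => g' x * A' ⟨x, μ'⟩

/-- **(3.26)** p. 440 [PDF 30] — PROVED UNCONDITIONALLY on the torus calculus: `B3Sect3VectorSelfEnergy.eq326` ((left side) = [square
bracket] + {first curly bracket} + {last curly bracket}) with its Taylor hypothesis `hT` supplied by (3.10) along `Γ_{x,x′}` applied to each
leg function `g′A′_{μ′}` (`taylor310_fwd`): `dx ν x x′ = (x′_ν − x_ν)`, `D ν μ′ = ∂^η_ν(g′A′_{μ′})`, `R μ′ = remFwd η⁻¹ (g′A′_{μ′})`.
[cite: Balaban1983Higgs3, (3.26) p.440] -/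
theorem eq326_taylor (η : ℝ) (hη : η ≠ 0) (τ : ℝ) (Gj Gj' Gj'' : Kernel P j) (g g' : SiteField P j ℝ) (A A' : VecField P j ℝ) :
    lhs326 η τ Gj Gj' Gj'' g g' A A' =
      bracket326 η τ Gj Gj' Gj'' g g' A A'
        + curly1 η τ Gj Gj' g A (fun ν x x' => disp η⁻¹ x x' ν) (fun ν μ' => pdiff η⁻¹ ν (legFn g' A' μ'))
        + curly2 η τ Gj Gj' g A (fun μ' x x' => remFwd η⁻¹ (legFn g' A' μ') x x') := by
  refine eq326 η τ Gj Gj' Gj'' g g' A A' _ _ _ fun μ' x x' => ?_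
  have h := taylor310_fwd η⁻¹ (inv_ne_zero hη) (legFn g' A' μ') x x'
  simp only [legFn, smul_eq_mul] at h ⊢
  linarith

end Eq326

end

end Literature.MathematicalPhysics.QuantumFieldTheory.Balaban1983to89.B3Taylor310Remainder
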